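import Literature.IUT.HodgeArakelov.MonoThetaSymmetries
import Literature.IUT.HodgeArakelov.MonoThetaProjectiveModelSystem
import Literature.AnabelianGeometry.EtaleTheta.MuTwoSettingCLevel
import Literature.AnabelianGeometry.EtaleTheta.Discharge.Sec1DeltaYuuEllZHat
import HarnessLib

/-!
# [IUTchII] Rmk. 1.1.1 (i): NON-VACUITY of `CoreTower` — the tower `Π_Y ⊆ Π_X̲ ⊆ Π_C ⊇ Π_X ⊇ Π_X̲̲` with
# `Δ^ell_Y ≅ Ẑ` EXISTS at the [EtTh] model (GENUINE witness over the C-level data)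

Mochizuki, *Inter-universal Teichmüller theory II*, §1, Remark 1.1.1 (i), kurims manuscript (Dec. 2020) pp. 21–22
[claim: Mochizuki2012, status: disputed] (IUTchII §1 Rmk 1.1.1 (i), kurims pp.21-22): "the topological group `Π_X(M)`
determines topological groups `Π_Y(M)`, `Π_X̲(M)`, and `Π_C(M)` … all of which may be regarded as open subgroups of
`Π_C(M)`: `Π_Y(M) ⊆ Π_X̲(M) ⊆ Π_C(M) (⊇ Π_X(M) ⊇ Π_X̲̲(M))` that are equipped with compatible surjections to `G(M)` …
one may reconstruct … the quotient `Π_M ↠ Π_Y(M) ↠ Π^ell_Y(M)` [isomorphic to `Ẑ(1) ⋊ G_k`]."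
Record-only vocabulary under the claim key `Mochizuki2012` (D-0012, disputed); abc-iut cell, layer L6, NV-L6 register
row **CoreTower** (plan/L6/NODES.md: «NV-BLOCKED — needs model `Π_C ⊇ Π_X̲` overgroups + `(Δ^tp_Y)^ell ≃* Ẑ` at the §1
model»; both inputs have since landed), seat abc-iut-w5-d225 (gen 5; producer (P1) of the NV-L6/TwoSections list of
abc-iut-w5-d225 gen 2): a NON-VACUITY CERTIFICATE for abc-iut-L6-t1's interface `CoreTower R`
(`MonoThetaSymmetries.lean`), whose field-derived type `W.DeltaYell = Δ_Y(M) ⧸ (Ker ∩ Δ_Y(M))` is the codomain factor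
of the commutator map of `TwoSections` (Rmk. 1.1.1 (iii)).

WITNESS (GENUINE, labels `…_of_cLevelData` / `…_modelRecon`): for the [IUTchII] Def. 1.1 (i) output
`F.reconstruction e` (abc-iut-L6-d6, B8 part 5b) of a mono-theta environment identified with the [EtTh] model of
abc-iut-L2-t8's rigidity data `C.rigidData μ hC hS h15 L` of a covering `X̲̲ → X` (`C : E.DoubleUnderline l` over a
`MuTwoSetting` — [EtTh] Def. 1.7: the §1 setting WITH the tempered group `Π^tp_C` of the orbicurve `C = X/±1`) and
abc-iut-L2-d3's C-level parameter record `cl : CLevelData` (`Π^tp_X ↪ Π^tp_C` an OPEN EMBEDDING, the augmentation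
`Π^tp_C ↠ G_K` extending that of `Π^tp_X`, `MuTwoSettingCLevel.lean`):
* `Π_C(M) := Π^tp_C`; `Π_X(M)`-of-the-display `:= inclX(Π^tp_X)`, `Π_X̲̲(M) := inclX(Π^tp_{X̲̲})`,
  `Π_X̲(M) := inclX(toZ⁻¹(l·ℤ))` (the degree-`l` subcovering of the `ℤ`-covering `Y → X`, [EtTh] Def. 2.1),
  `Π_Y(M) := inclX(Π^tp_{X̲̲} ∩ Π^tp_Y) = Π^tp_{Y̲̲}` — all OPEN (open embedding; `Π^tp_{X̲̲}`, `Ker(toZ)` open), with the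
  printed inclusions;
* `isoXbarbar : Π_X(M) = Π^tp_{X̲̲} ≃ₜ* inclX(Π^tp_{X̲̲})` — a homeomorphism BECAUSE `inclX` is an open embedding
  (`CLevelData.continuous_ofInjective_symm`), carrying `Π_Y(M) = Π^tp_Y ∩ Π^tp_{X̲̲}` onto `Π_Y`;
* `Π_C(M) ↠ G(M) = Π^tp_{X̲̲}/Δ`: the augmentation `augC` (image `G_K`, `CLevelData.range_augC`) followed by
  `G_K ≅ Π^tp_{X̲̲}/Δ` ("`G_K ≅ Π_X̲̲/Δ_X̲̲`", [EtTh] Prop. 2.2 (iii): `DoubleUnderline.map_aug_Huu`), SURJECTIVE and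
  compatible with `Π_X(M) ↠ G(M)` (`CLevelData.augC_inclX`);
* `Ker(Π_Y(M) ↠ Π^ell_Y(M)) := Ker(Π^tp_X ↠ (Π^tp_X)^Θ ↠ (Π^tp_X)^ell) ∩ Π^tp_{Y̲̲}` (normal), and
  `Δ_Y(M)/(Δ_Y(M) ∩ Ker) ≅ Ẑ` := abc-iut-w5-d024's `DoubleUnderline.nonempty_deltaYuuEll_mulEquiv_zHat`
  (`Discharge/Sec1DeltaYuuEllZHat.lean`, p428442: `(Δ^tp_{Y̲̲})^ell ≅ Ẑ`, over abc-iut-w5-d006's `(Δ^tp_Y)^ell ≅ Ẑ`,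
  p425316) transported along the tautological identification `Δ_Y(M) ≃* Π^tp_{X̲̲} ∩ Δ^tp_Y`
  (`mem_deltaY_reconstruction_iff`) — under that theorem's two binders `IsEtThOrigin` ([EtTh] §1 origin
  hypotheses, abc-iut-L2-t1) and `hYcl` («`(Δ^tp_Y)^Θ` is closed in its completion», GAP-LEDGER G-w4d021-2).
Hence `ModelFrame.exists_coreTower_of_cLevelData` / `nonempty_coreTower_of_cLevelData` and, at every level `M` of the
natural system of `X̲̲_K` (B8 part 5c, `EtaleLevels.modelRecon`), `EtaleLevels.exists_coreTower_modelRecon` /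
`nonempty_coreTower_modelRecon`; the `exists_` forms record `W.PiC = Π^tp_C` and the formula for `W.kerEll` (the only
datum of `W` that `TwoSections` consumes). PROOF-ONLY (no `def`/`instance`/`structure`: the witness is built inside the
theorem term). HONEST FRAMING: a kernel fact about the cell's own typed interfaces ([EtTh] refereed; the C-level record,
`IsEtThOrigin` and `hYcl` are explicit hypotheses, not facts); nothing of [IUTchII] is asserted; no side taken on
[IUTchIII] Cor. 3.12; typed ≠ discharged; witnessed ≠ endorsed. Node IUTchII:Rmk1.1.1 lies OUTSIDE the Cor. 3.12 cone.
[cite: MochizukiEtTh2009, Def 1.7 p.27] [cite: MochizukiEtTh2009, Prop 2.2 (iii) p.37]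
-/

noncomputable section

namespace Literature.IUT.HodgeArakelov

open Literature.AnabelianGeometry.EtaleTheta Literature.AnabelianGeometry.SemiGraphs
open scoped Literature.AnabelianGeometry.EtaleTheta

namespace ModelFrame

variable {p : ℕ} [Fact p.Prime] {Mt : MuTwoSetting p}
  {E : Mt.toThetaSetting.EtaleThetaData} {l : ℕ} (C : E.DoubleUnderline l)
  {S : ThetaSetting.{0}} (μ : Mt.toThetaSetting.CyclotomeMod l S.N)
  (hC : Mt.toThetaSetting.Compat) (hS : Mt.toThetaSetting.Sec2Hyps)
  (h15 : ThetaSetting.Prop15iii E hC) (L : C.CuspLabels)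
  (F : ModelFrame S (C.rigidData μ hC hS h15 L)) {Menv : MonoThetaEnv S}
  (e : Menv.Pi ≃ₜ* (C.rigidData μ hC hS h15 L).env)

/-- **`Δ_Y(M) = Π^tp_{Y̲̲} ∩ Δ`** for the genuine reconstruction ([IUTchII] Def. 1.1 (i) "`Δ_Y(M) := Ker(Π_Y(M) ↠ G(M))`",
at B8's `F.reconstruction e` over the rigidity data of `X̲̲`): `y ∈ Δ_Y(M) ↔ aug y = 1` in `G_{ℚ_p}`.
[claim: Mochizuki2012, status: disputed] (IUTchII §1 Def 1.1 (i), kurims p.21) -/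
theorem mem_deltaY_reconstruction_iff (y : ↥(Mt.GtpY.subgroupOf C.Huu)) :
    y ∈ (F.reconstruction e).DeltaY ↔ Mt.aug ((y : ↥C.Huu) : Mt.PiTemp) = 1 := by
  rw [MonoidHom.mem_ker, MonoidHom.comp_apply, QuotientGroup.mk'_apply, QuotientGroup.eq_one_iff,
    MonoidHom.mem_ker, ← OneMemClass.coe_eq_one]
  rfl

/-- **IUTchII:Rmk1.1.1(i) — NON-VACUITY of `CoreTower` at the [EtTh] model, GENUINE witness with its two exposed data**:
for the Def. 1.1 (i) output `F.reconstruction e` of a mono-theta environment identified with the model of the rigidity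
data of `X̲̲ → X` over a `MuTwoSetting` with C-level record `cl`, under `IsEtThOrigin` and `hYcl`, THERE IS a
`W : CoreTower (F.reconstruction e)` with `Π_C(M) = Π^tp_C` (`W.PiC = TopGroup.of Mt.GtpC`) and
`Ker(Π_Y(M) ↠ Π^ell_Y(M)) = Ker(Π^tp_X ↠ (Π^tp_X)^ell) ∩ Π^tp_{Y̲̲}` (the formula for `W.kerEll`, the datum
`TwoSections` consumes through `W.DeltaYell`); the tower is `inclX(Π^tp_{X̲̲} ∩ Π^tp_Y) ⊆ inclX(toZ⁻¹(l·ℤ)) ⊆ Π^tp_C ⊇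
inclX(Π^tp_X) ⊇ inclX(Π^tp_{X̲̲})`, `Π_C ↠ G(M)` is `augC` followed by `G_K ≅ Π^tp_{X̲̲}/Δ`, and `Δ^ell_Y ≅ Ẑ` is
abc-iut-w5-d024's `(Δ^tp_{Y̲̲})^ell ≅ Ẑ`. [claim: Mochizuki2012, status: disputed] (IUTchII §1 Rmk 1.1.1 (i), kurims pp.21-22) -/
theorem exists_coreTower_of_cLevelData (cl : Mt.CLevelData) (hO : Mt.toThetaSetting.IsEtThOrigin)
    (hYcl : (Mt.DtpY.map Mt.toHat.toMonoidHom).topologicalClosure ≤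
      Mt.DtpY.map Mt.toHat.toMonoidHom ⊔ (⁅⁅Mt.DeltaHat, Mt.DeltaHat⁆, Mt.DeltaHat⁆).topologicalClosure) :
    ∃ W : CoreTower (F.reconstruction e), W.PiC = TopGroup.of Mt.GtpC ∧
      W.kerEll = ((Mt.thetaToEll.comp Mt.toTheta).ker).comap
        (C.Huu.subtype.comp (Mt.GtpY.subgroupOf C.Huu).subtype) := by
  classical
  -- ### notation
  set R : RigidData S.N l := C.rigidData μ hC hS h15 L with hRdef
  have hι : Topology.IsOpenEmbedding Mt.inclX := cl.isOpenEmbedding_inclX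
  -- ### `(Δ^tp_{Y̲̲})^ell ≅ Ẑ` (abc-iut-w5-d024, `Discharge/Sec1DeltaYuuEllZHat`)
  obtain ⟨eδ⟩ := C.nonempty_deltaYuuEll_mulEquiv_zHat hO hYcl
  -- ### the open embedding `Π^tp_{X̲̲} ≃ₜ* inclX(Π^tp_{X̲̲})`
  have hmemrange : ∀ y : ↥(C.Huu.map Mt.inclX), (y : Mt.GtpC) ∈ Mt.inclX.range := fun y =>
    Subgroup.map_le_range _ _ y.2
  have hinv_mem : ∀ y : ↥(C.Huu.map Mt.inclX),
      (MonoidHom.ofInjective Mt.injective_inclX).symm ⟨y, hmemrange y⟩ ∈ C.Huu := by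
    intro y
    obtain ⟨x, hx, hxy⟩ := Subgroup.mem_map.1 y.2
    have : (MonoidHom.ofInjective Mt.injective_inclX).symm ⟨y, hmemrange y⟩ = x :=
      Mt.injective_inclX (by rw [MonoidHom.apply_ofInjective_symm]; exact hxy.symm)
    rw [this]; exact hx
  let iX : ↥C.Huu ≃ₜ* ↥(C.Huu.map Mt.inclX) :=
    { toFun := fun x => ⟨Mt.inclX x, Subgroup.mem_map_of_mem Mt.inclX x.2⟩
      invFun := fun y => ⟨(MonoidHom.ofInjective Mt.injective_inclX).symm ⟨y, hmemrange y⟩, hinv_mem y⟩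
      left_inv := fun x => by
        apply Subtype.ext
        apply Mt.injective_inclX
        simp only [MonoidHom.apply_ofInjective_symm]
      right_inv := fun y => by
        apply Subtype.ext
        simp only [MonoidHom.apply_ofInjective_symm]
      map_mul' := fun x y => Subtype.ext (by simp only [Subgroup.coe_mul, map_mul])
      continuous_toFun := (Mt.continuous_inclX.comp continuous_subtype_val).subtype_mk _
      continuous_invFun := by
        apply Continuous.subtype_mk
        exact cl.continuous_ofInjective_symm.comp (continuous_subtype_val.subtype_mk _) }
  -- ### the surjection `Π^tp_C ↠ G(M) = Π^tp_{X̲̲}/Δ ≅ G_K`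
  have haugC_mem : ∀ g : Mt.GtpC, cl.augC g ∈ Mt.GK := fun g => by
    rw [← cl.range_augC]; exact ⟨g, rfl⟩
  let aC : Mt.GtpC →* ↥Mt.GK := cl.augC.toMonoidHom.codRestrict Mt.GK haugC_mem
  have aC_surj : Function.Surjective aC := by
    intro γ
    have hγ : (γ : GQp p) ∈ cl.augC.range := by rw [cl.range_augC]; exact γ.2
    obtain ⟨g, hg⟩ := hγ
    exact ⟨g, Subtype.ext hg⟩
  let eG : (↥C.Huu ⧸ R.aug.ker) ≃* ↥Mt.GK :=
    QuotientGroup.quotientKerEquivOfSurjective R.aug R.aug_surjective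
  have eG_mk : ∀ x : ↥C.Huu, eG (QuotientGroup.mk x) = R.aug x := fun _ => rfl
  let π : Mt.GtpC →* (↥C.Huu ⧸ R.aug.ker) := eG.symm.toMonoidHom.comp aC
  -- ### `Ker(Π_Y(M) ↠ Π^ell_Y(M))` : `Ker(Π^tp_X ↠ (Π^tp_X)^ell)` pulled back to `Π_Y(M) = Π^tp_{Y̲̲}`
  let K₀ : Subgroup Mt.PiTemp := (Mt.thetaToEll.comp Mt.toTheta).ker
  let kerEll : Subgroup ↥(Mt.GtpY.subgroupOf C.Huu) :=
    K₀.comap (C.Huu.subtype.comp (Mt.GtpY.subgroupOf C.Huu).subtype)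
  haveI hK₀n : K₀.Normal := MonoidHom.normal_ker _
  haveI hkn : kerEll.Normal := Subgroup.Normal.comap hK₀n _
  -- ### transport `Δ_Y(M) ≃* Π^tp_{X̲̲} ∩ Δ^tp_Y` (tautological: both are `{x ∈ Π^tp_{X̲̲} ∩ Π^tp_Y | aug x = 1}`)
  let φ : ↥(F.reconstruction e).DeltaY ≃* ↥(C.Huu ⊓ Mt.DtpY) :=
    { toFun := fun y => ⟨((y.1 : ↥C.Huu) : Mt.PiTemp),
        ⟨(y.1 : ↥C.Huu).2, ⟨Subgroup.mem_subgroupOf.1 y.1.2,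
          (mem_deltaY_reconstruction_iff C μ hC hS h15 L F e y.1).1 y.2⟩⟩⟩
      invFun := fun z => ⟨⟨⟨z.1, z.2.1⟩, Subgroup.mem_subgroupOf.2 z.2.2.1⟩,
        (mem_deltaY_reconstruction_iff C μ hC hS h15 L F e _).2 z.2.2.2⟩
      left_inv := fun _ => rfl
      right_inv := fun _ => rfl
      map_mul' := fun _ _ => rfl }
  have hφ : Subgroup.map (↑φ) (kerEll.subgroupOf (F.reconstruction e).DeltaY) =
      K₀.subgroupOf (C.Huu ⊓ Mt.DtpY) := by
    ext z
    constructor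
    · rintro ⟨y, hy, rfl⟩
      exact hy
    · intro hz
      exact ⟨φ.symm z, hz, φ.apply_symm_apply z⟩
  haveI : (K₀.subgroupOf (C.Huu ⊓ Mt.DtpY)).Normal := inferInstance
  haveI : (kerEll.subgroupOf (F.reconstruction e).DeltaY).Normal := inferInstance
  -- ### assembly
  refine ⟨{ PiC := TopGroup.of Mt.GtpC
            Y := (C.Huu ⊓ Mt.GtpY).map Mt.inclX
            Xbar := ((Subgroup.zpowers (Multiplicative.ofAdd (l : ℤ))).comap Mt.toZ).map Mt.inclX
            X := Mt.inclX.range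
            Xbarbar := C.Huu.map Mt.inclX
            Y_le_Xbar := ?_
            Xbarbar_le_X := Subgroup.map_le_range _ _
            Y_le_Xbarbar := Subgroup.map_mono inf_le_left
            isOpen_Y := ?_
            isOpen_Xbar := ?_
            isOpen_X := Mt.isOpen_range_inclX
            isOpen_Xbarbar := ?_
            isoXbarbar := iX
            isoXbarbar_Y := ?_
            projG := π
            projG_surjective := eG.symm.surjective.comp aC_surj
            projG_compat := ?_
            kerEll := kerEll
            kerEll_normal := hkn
            deltaEll_iso := ⟨(QuotientGroup.congr _ _ φ hφ).trans eδ⟩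
            deltaEll_normal := inferInstance }, rfl, rfl⟩
  · -- `Π_Y ⊆ Π_X̲` : `Π^tp_Y = Ker(toZ) ≤ toZ⁻¹(l·ℤ)`
    refine Subgroup.map_mono (le_trans inf_le_right ?_)
    intro x hx
    have hx1 : Mt.toZ x = 1 := hx
    simp only [Subgroup.mem_comap, hx1, one_mem]
  · -- `Π_Y` open
    rw [Subgroup.coe_map]
    exact hι.isOpenMap _ (C.isOpen_Huu.inter Mt.toThetaSetting.isOpen_ker_toZ)
  · -- `Π_X̲` open : it contains the open subgroup `Ker(toZ)`
    rw [Subgroup.coe_map]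
    refine hι.isOpenMap _ (Subgroup.isOpen_mono ?_ Mt.toThetaSetting.isOpen_ker_toZ)
    intro x hx
    have hx1 : Mt.toZ x = 1 := hx
    simp only [Subgroup.mem_comap, hx1, one_mem]
  · -- `Π_X̲̲` open
    rw [Subgroup.coe_map]
    exact hι.isOpenMap _ C.isOpen_Huu
  · -- `isoXbarbar` carries `Π_Y(M) = Π^tp_Y ∩ Π^tp_{X̲̲}` onto `Π_Y = inclX(Π^tp_{X̲̲} ∩ Π^tp_Y)`
    ext g
    constructor
    · intro hg
      obtain ⟨y, hy, hyg⟩ := Subgroup.mem_map.1 hg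
      obtain ⟨y', hy'⟩ := MonoidHom.mem_range.1 hy
      subst hy'
      subst hyg
      exact Subgroup.mem_map.2
        ⟨((y' : ↥C.Huu) : Mt.PiTemp), ⟨(y' : ↥C.Huu).2, Subgroup.mem_subgroupOf.1 y'.2⟩, rfl⟩
    · intro hg
      obtain ⟨x, hx, hxg⟩ := Subgroup.mem_map.1 hg
      subst hxg
      exact Subgroup.mem_map.2 ⟨⟨x, hx.1⟩,
        MonoidHom.mem_range.2 ⟨⟨⟨x, hx.1⟩, Subgroup.mem_subgroupOf.2 hx.2⟩, rfl⟩, rfl⟩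
  · -- compatibility of `Π_C ↠ G(M)` with `Π_X(M) ↠ G(M)` : `augC ∘ inclX = aug`
    intro x
    change eG.symm (aC (Mt.inclX x)) = QuotientGroup.mk x
    rw [MulEquiv.symm_apply_eq, eG_mk]
    apply Subtype.ext
    change cl.augC (Mt.inclX x) = _
    rw [cl.augC_inclX]
    rfl

/-- **IUTchII:Rmk1.1.1(i) — `CoreTower (F.reconstruction e)` is INHABITED** (GENUINE witness of
`exists_coreTower_of_cLevelData`, over the C-level data of a `MuTwoSetting`, under `IsEtThOrigin` + `hYcl`).
[claim: Mochizuki2012, status: disputed] (IUTchII §1 Rmk 1.1.1 (i), kurims pp.21-22) -/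
theorem nonempty_coreTower_of_cLevelData (cl : Mt.CLevelData) (hO : Mt.toThetaSetting.IsEtThOrigin)
    (hYcl : (Mt.DtpY.map Mt.toHat.toMonoidHom).topologicalClosure ≤
      Mt.DtpY.map Mt.toHat.toMonoidHom ⊔ (⁅⁅Mt.DeltaHat, Mt.DeltaHat⁆, Mt.DeltaHat⁆).topologicalClosure) :
    Nonempty (CoreTower (F.reconstruction e)) := by
  obtain ⟨W, -, -⟩ := exists_coreTower_of_cLevelData C μ hC hS h15 L F e cl hO hYcl
  exact ⟨W⟩

end ModelFrame

/-! ## At every level `M` of the natural system of `X̲̲_K` (B8 part 5c) -/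

namespace EtaleLevels

variable {p : ℕ} [Fact p.Prime] {Mt : MuTwoSetting p}
  {E : Mt.toThetaSetting.EtaleThetaData} {l : ℕ} (C : E.DoubleUnderline l)
  (hC : Mt.toThetaSetting.Compat) (hS : Mt.toThetaSetting.Sec2Hyps)
  (hl : l.Prime) (hp2 : p ≠ 2) (hpl : p ≠ l) (hζ : ∃ ζ : Mt.K, IsPrimitiveRoot ζ (4 * l))
  (mods : ∀ M : ℕ+, Mt.toThetaSetting.CyclotomeMod l M)
  (f : contCocycles Mt.toTheta Mt.DeltaTheta C.GtpYdduu) (hf : f ∈ C.rootCocycles hC)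
  (h15 : ThetaSetting.Prop15iii E hC) (L : C.CuspLabels)
  (hZ : ∀ M : ℕ+, Nonempty (ModelCyclotomes.lDeltaQuot (C.rigidData (mods M) hC hS h15 L) ≃*
    Literature.IUT.HodgeTheaters.ZHat))

/-- **`CoreTower (𝕄_M)` EXISTS at every level `M` of the natural system of model mono-theta environments of
`X̲̲_K`** (abc-iut-w4-d030's `EtaleLevels.modelRecon`), GENUINE witness with `Π_C(𝕄_M) = Π^tp_C` and the formula for
`Ker(Π_Y(𝕄_M) ↠ Π^ell_Y(𝕄_M))`, over the C-level data, under `IsEtThOrigin` + `hYcl`.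
[claim: Mochizuki2012, status: disputed] (IUTchII §1 Rmk 1.1.1 (i), kurims pp.21-22) -/
theorem exists_coreTower_modelRecon (cl : Mt.CLevelData) (hO : Mt.toThetaSetting.IsEtThOrigin)
    (hYcl : (Mt.DtpY.map Mt.toHat.toMonoidHom).topologicalClosure ≤
      Mt.DtpY.map Mt.toHat.toMonoidHom ⊔ (⁅⁅Mt.DeltaHat, Mt.DeltaHat⁆, Mt.DeltaHat⁆).topologicalClosure)
    (M : ℕ+) :
    ∃ W : CoreTower (modelRecon C hC hS hl hp2 hpl hζ mods f hf h15 L hZ M), W.PiC = TopGroup.of Mt.GtpC ∧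
      W.kerEll = ((Mt.thetaToEll.comp Mt.toTheta).ker).comap
        (C.Huu.subtype.comp (Mt.GtpY.subgroupOf C.Huu).subtype) := by
  unfold modelRecon
  exact ModelFrame.exists_coreTower_of_cLevelData (S := levelSetting C hC hS hl hp2 hpl hζ mods f hf M) C (mods M)
    hC hS h15 L (modelFrame C hC hS hl hp2 hpl hζ mods f hf h15 L hZ M) _ cl hO hYcl

/-- **`CoreTower (𝕄_M)` is INHABITED at every level `M` of the natural system of `X̲̲_K`** (GENUINE witness).
[claim: Mochizuki2012, status: disputed] (IUTchII §1 Rmk 1.1.1 (i), kurims pp.21-22) -/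
theorem nonempty_coreTower_modelRecon (cl : Mt.CLevelData) (hO : Mt.toThetaSetting.IsEtThOrigin)
    (hYcl : (Mt.DtpY.map Mt.toHat.toMonoidHom).topologicalClosure ≤
      Mt.DtpY.map Mt.toHat.toMonoidHom ⊔ (⁅⁅Mt.DeltaHat, Mt.DeltaHat⁆, Mt.DeltaHat⁆).topologicalClosure)
    (M : ℕ+) :
    Nonempty (CoreTower (modelRecon C hC hS hl hp2 hpl hζ mods f hf h15 L hZ M)) := by
  obtain ⟨W, -, -⟩ := exists_coreTower_modelRecon C hC hS hl hp2 hpl hζ mods f hf h15 L hZ cl hO hYcl M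
  exact ⟨W⟩

end EtaleLevels

end Literature.IUT.HodgeArakelov

end
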